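import Summits.ABC.ABC.Theses.IsogenyGlueCongruence
import Literature.NumberTheory.EllipticCurves.HeightCovolumeBoundsProofs

/-!
# `PolyHeightOfBoundedPrimes` (stmt-ABC-16006, crux B′) — line `Sketch` (card `archimedean-hall-split`):
the registered CALIBRATION stub `stub_hallHalf_iff_polyJ` (the Hall half in `j`-form)

Crux `B′ = A → H` of route IsogenyGlueCongruence (`H`: `max(|Δ_W|, |c₄(W)|³) ≤ C·N_W^σ` on semistable
global minimal elliptic `W/ℚ`). The line splits `H` into a finite half `PolySzpiroΔ` (`|Δ_W| ≤ C·N_W^σ`)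
and an archimedean "Hall half" `PolyHallΔ : ∃ σ' C, 0 ≤ σ' ∧ ∀ W, |c₄(W)|³ ≤ C·|Δ_W|^{σ'}`. This file
restates the Hall half in `j`-FORM: since `j = c₄³/Δ`, i.e. `|c₄(W)|³ = |j(W)|·|Δ_W|`, the Hall half is
EQUIVALENT to a polynomial bound of the archimedean size of `j` by the minimal discriminant,
`|j(W)| ≤ C·|Δ_W|^{σ}` (`log⁺|j(W)| ≤ σ·log|Δ_min| + O(1)`), over the same class of curves. It lands

* `abs_j_mul_abs_Δ`, `cast_abs_j_mul_cast_abs_Δ` — the identity `|j(W)|·|Δ_W| = |c₄(W)|³` for an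
  elliptic `W/ℚ` (in `ℚ`, and cast to `ℝ` in the coercions of the registered stubs);
* `abs_j_le_of_abs_c₄_pow_three_le` — pointwise (→): on a global minimal model `1 ≤ N_W ≤ |Δ_W|`
  (`conductorNorm_pos_holds`, `conductorNorm_le_abs_Δ`), so `|j| = |c₄|³/|Δ| ≤ |c₄|³ ≤ C·|Δ|^σ`;
* `abs_c₄_pow_three_le_of_abs_j_le` — pointwise (←): `|c₄|³ = |j|·|Δ| ≤ C·|Δ|^σ·|Δ| = C·|Δ|^{σ+1}`;
* `polyJ_of_hallHalf` (exponent kept), `hallHalf_of_polyJ` (exponent `σ + 1`) — the two directions;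
* `stub_hallHalf_iff_polyJ` — the REGISTERED stub (name and signature verbatim).

Semistability and `NeZero (W.conductorNorm ℤ)` are carried along but not used.

Supports stmt-ABC-16006 (registered stub verbatim; curried pointwise forms as corollaries).
Nothing here closes the item.
-/

noncomputable section

-- single-conjunct summit ABC: the duplicate ABC.ABC is mandated (CONVENTIONS §2)
set_option linter.dupNamespace false

namespace Summit.ABC.ABC.Theorems.PolyHeightOfBoundedPrimes.HallSplit

open WeierstrassCurve
open Summit.ABC.ABC.Theses.IsogenyGlueCongruence

/-- **`|j(W)| · |Δ_W| = |c₄(W)|³`** for an elliptic curve `W/ℚ`: `j = Δ⁻¹·c₄³ = c₄³/Δ` with `Δ ≠ 0`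
(Silverman AEC III.1). [folklore] -/
theorem abs_j_mul_abs_Δ (W : WeierstrassCurve ℚ) [W.IsElliptic] : |W.j| * |W.Δ| = |W.c₄| ^ 3 := by
  have hΔ : W.Δ ≠ 0 := W.isUnit_Δ.ne_zero
  have hj : W.j = W.c₄ ^ 3 / W.Δ := by
    rw [WeierstrassCurve.j, Units.val_inv_eq_inv_val, WeierstrassCurve.coe_Δ', div_eq_inv_mul]
  rw [hj, abs_div, abs_pow, div_mul_cancel₀ _ (abs_ne_zero.mpr hΔ)]

/-- The identity `|j(W)| · |Δ_W| = |c₄(W)|³` cast to `ℝ`, in the coercions of the registered stubs.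
[folklore] -/
theorem cast_abs_j_mul_cast_abs_Δ (W : WeierstrassCurve ℚ) [W.IsElliptic] :
    ((|W.j| : ℚ) : ℝ) * ((|W.Δ| : ℚ) : ℝ) = ((|W.c₄| ^ 3 : ℚ) : ℝ) := by
  rw [← Rat.cast_mul, abs_j_mul_abs_Δ]

/-- **Hall half ⟹ `j`-form, pointwise.** On a global minimal model `1 ≤ N_W ≤ |Δ_W|`
(`conductorNorm_pos_holds`, `conductorNorm_le_abs_Δ`), hence
`|j(W)| ≤ |j(W)|·|Δ_W| = |c₄(W)|³ ≤ C·|Δ_W|^σ`. [folklore] -/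
theorem abs_j_le_of_abs_c₄_pow_three_le {σ C : ℝ} (W : WeierstrassCurve ℚ) [W.IsElliptic]
    [W.IsGloballyMinimal] (h : ((|W.c₄| ^ 3 : ℚ) : ℝ) ≤ C * ((|W.Δ| : ℚ) : ℝ) ^ σ) :
    ((|W.j| : ℚ) : ℝ) ≤ C * ((|W.Δ| : ℚ) : ℝ) ^ σ := by
  have hN : 0 < W.conductorNorm ℤ := W.conductorNorm_pos_holds
  have hN1 : (1 : ℝ) ≤ (W.conductorNorm ℤ : ℝ) := by exact_mod_cast hN
  have hΔ1 : (1 : ℝ) ≤ ((|W.Δ| : ℚ) : ℝ) :=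
    hN1.trans (Literature.NumberTheory.EllipticCurves.conductorNorm_le_abs_Δ W)
  have hj0 : (0 : ℝ) ≤ ((|W.j| : ℚ) : ℝ) := by exact_mod_cast abs_nonneg W.j
  calc ((|W.j| : ℚ) : ℝ) ≤ ((|W.j| : ℚ) : ℝ) * ((|W.Δ| : ℚ) : ℝ) := le_mul_of_one_le_right hj0 hΔ1
    _ = ((|W.c₄| ^ 3 : ℚ) : ℝ) := cast_abs_j_mul_cast_abs_Δ W
    _ ≤ C * ((|W.Δ| : ℚ) : ℝ) ^ σ := h

/-- **`j`-form ⟹ Hall half, pointwise** (exponent `σ + 1`): for an elliptic `W/ℚ` (`Δ_W ≠ 0`),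
`|c₄(W)|³ = |j(W)|·|Δ_W| ≤ (C·|Δ_W|^σ)·|Δ_W| = C·|Δ_W|^{σ+1}`. [folklore] -/
theorem abs_c₄_pow_three_le_of_abs_j_le {σ C : ℝ} (W : WeierstrassCurve ℚ) [W.IsElliptic]
    (h : ((|W.j| : ℚ) : ℝ) ≤ C * ((|W.Δ| : ℚ) : ℝ) ^ σ) :
    ((|W.c₄| ^ 3 : ℚ) : ℝ) ≤ C * ((|W.Δ| : ℚ) : ℝ) ^ (σ + 1) := by
  have hΔ : W.Δ ≠ 0 := W.isUnit_Δ.ne_zero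
  have hΔpos : (0 : ℝ) < ((|W.Δ| : ℚ) : ℝ) := by exact_mod_cast abs_pos.mpr hΔ
  calc ((|W.c₄| ^ 3 : ℚ) : ℝ) = ((|W.j| : ℚ) : ℝ) * ((|W.Δ| : ℚ) : ℝ) :=
        (cast_abs_j_mul_cast_abs_Δ W).symm
    _ ≤ C * ((|W.Δ| : ℚ) : ℝ) ^ σ * ((|W.Δ| : ℚ) : ℝ) := mul_le_mul_of_nonneg_right h hΔpos.le
    _ = C * ((|W.Δ| : ℚ) : ℝ) ^ (σ + 1) := by rw [Real.rpow_add_one hΔpos.ne' σ, mul_assoc]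

/-- **Hall half ⟹ `j`-form** (same exponent and constant): `∃ σ C, 0 ≤ σ ∧ |c₄(W)|³ ≤ C·|Δ_W|^σ` over
semistable global minimal elliptic `W/ℚ` gives `∃ σ C, 0 ≤ σ ∧ |j(W)| ≤ C·|Δ_W|^σ` over the same class
(`abs_j_le_of_abs_c₄_pow_three_le`). [folklore] -/
theorem polyJ_of_hallHalf
    (hHall : ∃ σ C : ℝ, 0 ≤ σ ∧ ∀ (W : WeierstrassCurve ℚ) [W.IsElliptic] [W.IsGloballyMinimal]
      [NeZero (W.conductorNorm ℤ)], W.IsSemistable ℤ →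
        ((|W.c₄| ^ 3 : ℚ) : ℝ) ≤ C * ((|W.Δ| : ℚ) : ℝ) ^ σ) :
    ∃ σ C : ℝ, 0 ≤ σ ∧ ∀ (W : WeierstrassCurve ℚ) [W.IsElliptic] [W.IsGloballyMinimal]
      [NeZero (W.conductorNorm ℤ)], W.IsSemistable ℤ →
        ((|W.j| : ℚ) : ℝ) ≤ C * ((|W.Δ| : ℚ) : ℝ) ^ σ := by
  obtain ⟨σ, C, hσ, h⟩ := hHall
  exact ⟨σ, C, hσ, fun W _ _ _ hW ↦ abs_j_le_of_abs_c₄_pow_three_le W (h W hW)⟩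

/-- **`j`-form ⟹ Hall half** (exponent `σ + 1`, same constant): `∃ σ C, 0 ≤ σ ∧ |j(W)| ≤ C·|Δ_W|^σ`
over semistable global minimal elliptic `W/ℚ` gives `∃ σ C, 0 ≤ σ ∧ |c₄(W)|³ ≤ C·|Δ_W|^σ` over the
same class, with witness `(σ + 1, C)` (`abs_c₄_pow_three_le_of_abs_j_le`). [folklore] -/
theorem hallHalf_of_polyJ
    (hJ : ∃ σ C : ℝ, 0 ≤ σ ∧ ∀ (W : WeierstrassCurve ℚ) [W.IsElliptic] [W.IsGloballyMinimal]
      [NeZero (W.conductorNorm ℤ)], W.IsSemistable ℤ →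
        ((|W.j| : ℚ) : ℝ) ≤ C * ((|W.Δ| : ℚ) : ℝ) ^ σ) :
    ∃ σ C : ℝ, 0 ≤ σ ∧ ∀ (W : WeierstrassCurve ℚ) [W.IsElliptic] [W.IsGloballyMinimal]
      [NeZero (W.conductorNorm ℤ)], W.IsSemistable ℤ →
        ((|W.c₄| ^ 3 : ℚ) : ℝ) ≤ C * ((|W.Δ| : ℚ) : ℝ) ^ σ := by
  obtain ⟨σ, C, hσ, h⟩ := hJ
  exact ⟨σ + 1, C, add_nonneg hσ zero_le_one,
    fun W _ _ _ hW ↦ abs_c₄_pow_three_le_of_abs_j_le W (h W hW)⟩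

/-- **CALIBRATION STUB (registered on stmt-ABC-16006; line `Sketch`, card archimedean-hall-split):
the Hall half in `j`-form.** Over semistable global minimal elliptic `W/ℚ`, the Hall half
`∃ σ C, 0 ≤ σ ∧ |c₄(W)|³ ≤ C·|Δ_W|^σ` is EQUIVALENT to the polynomial bound
`∃ σ C, 0 ≤ σ ∧ |j(W)| ≤ C·|Δ_W|^σ` of the archimedean size of `j` by the minimal discriminant
(`|c₄|³ = |j|·|Δ|`, and `|Δ_W| ≥ 1` on a global minimal model; exponents `σ ↦ σ`, resp. `σ ↦ σ + 1`).
[folklore] -/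
theorem stub_hallHalf_iff_polyJ :
    (∃ σ C : ℝ, 0 ≤ σ ∧ ∀ (W : WeierstrassCurve ℚ) [W.IsElliptic] [W.IsGloballyMinimal]
      [NeZero (W.conductorNorm ℤ)], W.IsSemistable ℤ →
        ((|W.c₄| ^ 3 : ℚ) : ℝ) ≤ C * ((|W.Δ| : ℚ) : ℝ) ^ σ) ↔
    (∃ σ C : ℝ, 0 ≤ σ ∧ ∀ (W : WeierstrassCurve ℚ) [W.IsElliptic] [W.IsGloballyMinimal]
      [NeZero (W.conductorNorm ℤ)], W.IsSemistable ℤ →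
        ((|W.j| : ℚ) : ℝ) ≤ C * ((|W.Δ| : ℚ) : ℝ) ^ σ) :=
  ⟨polyJ_of_hallHalf, hallHalf_of_polyJ⟩

end Summit.ABC.ABC.Theorems.PolyHeightOfBoundedPrimes.HallSplit

end
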